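/-
Origin: expansion seat `prover-pub-hodgecm-mc-carch-1-g36-0`, handover #CA67 2026-08-21T01:50Z md5 28768fa8a505 (394 l.; NEW additive leaf; imports Model.ArchKTypeOfDistHol + Model.ArchKTypeOfSlotChar34; ns HodgeCM.Model; 12 theorems 0 defs; NAMES for audit: HodgeCM.Model.hd_lineOmega_twoG · HodgeCM.Model.hCR_lineOmega_twoG · HodgeCM.Model.hCR_lineOmega_threeG) (`HOME/mc/pub-hodgecm-mc-carch-1/stage69/HodgeCM/Model/ArchKTypeOfDistHol34.lean`, md5 28768fa8a505, 394 lines);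
landed by the gen-29 packager (p-g29) in gate run 69 as `HodgeCM/Model/ArchKTypeOfDistHol34.lean` (verbatim).
-/
/-
Copyright (c) 2026 the pub-hodgecm formalisation cell (harness21).  New file, not vendored.
Origin: session prover-pub-hodgecm-mc-carch-1-g36-0 (unit pub-hodgecm-mc-carch-1, C / ARCHDATUM BUILDER gen 36; SLOTS 2 AND 3 of the (J4) input:
the line-2/3 clone of #CA62 `Model/ArchKTypeOfDistHol` — (a4) `hd` / (a5) `hCR` for sinst-1's `thetaDistDatumTwoOf/ThreeOf` (#1258/#1259)), 2026-08-21.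
Intended final place: `HodgeCM/Model/ArchKTypeOfDistHol34.lean` (NEW additive model-layer leaf; imports installed carch #CA62 `Model/ArchKTypeOfDistHol`
(the record-free `ArchPair` bricks) + #W11 `Model/ArchKTypeOfSlotChar34`; nothing imports it; drop alone).
-/
import Summits.HodgeConjecture.HodgeCM.Model.ArchKTypeOfDistHol_2
import Summits.HodgeConjecture.HodgeCM.Model.ArchKTypeOfSlotChar34_2

/-!
# (AN) and (REP′) for the honest archimedean factors of LINES 2 AND 3 on the harmonic family, record-free

The line-2/3 twin of #CA62 `Model/ArchKTypeOfDistHol` § 2–§ 3 (its § 1 `ArchPair` bricks are imported, not re-proved): for `k = 2, 3`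
(conjugated plane `dW' c.D`, splittings `hGR₂/hGR₃`, scalars `η₂/η₃`)

* `lineOmega_two/three_twistU21_expP_symm_applyG`, **`differentiableAt_lineOmega_two/three_twistU21_expPG`**, **`pMinus_lineOmega_two/three_twistU21_expPG`**
  — (AN)/(REP′) along `twistU21 ∘ expP` from the junction bricks `ArchPair.differentiableAt/pMinus_of_blockPair` at the block datum of the
  slot (`isArchWeilDatum_cmBlockAt` with the conjugated line's sign facts `frameD_sign_ι₁'`, `line_hs₁W_of_real`, `frameD_sign_of_ne`, `line_hsW` —
  ALL HYPOTHESIS-FREE — and #W11 `lineOmega_two/three_twistU21_expP_AtG`);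
* with the canonical representative `hemb`: **`hd_lineOmega_two/threeG`** ((a4) of #1259 VERBATIM), `pMinus_lineOmega_two/threeG`,
  **`hCR_lineOmega_two/threeG`** ((a5) VERBATIM; `ThetaHolDirections.apply_I_smul_of_basis` + `ThetaHolAssembly.fderiv_I_smul_of_slopes`).

Inputs `eR eS Φ₂` only (no `h₁W`: the sign of a conjugated line at `ι₁` is read off `dW'_real/dW'_ne`).  Nothing cited, nothing minted;
0 records, 0 defs, 0 `def … : Prop`.
-/

set_option autoImplicit false

noncomputable section

open Filter Topology Complex
open NumberField NumberField.InfinitePlace NumberField.mixedEmbedding IsDedekindDomain MeasureTheory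
open scoped Matrix TensorProduct Classical SchwartzMap
open MulAction
open Literature.Geometry.ComplexHyperbolic.BallModel (U21 x₀ stabilizerEquivK21)
open Literature.NumberTheory.Automorphic.U21 (K21 matA sclD pPlus pPlus_apply)
open Literature.AlgebraicGeometry.HodgeTheory
open Literature.AlgebraicGeometry.ShimuraVarieties Literature.AlgebraicGeometry.ShimuraVarieties.BallForms
open Literature.NumberTheory.Automorphic Literature.NumberTheory.Weil1964
open Literature.RepresentationTheory.HeisenbergGroup (polar Heisenberg symplecticGroup ofSymplectic)
open Literature.RepresentationTheory.KonnoKonno2007 Literature.RepresentationTheory.KonnoKonno2007.RealDualPair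
open Literature.NumberTheory.GelbartRogawski1991 Literature.NumberTheory.GelbartRogawski1991.UnitaryDualPair
open Literature.Analysis.SegalBargmann Literature.Analysis.Distribution
open Literature.NumberTheory.Automorphic.PicardCM
open HodgeCM.Adelic HodgeCM.PerL34 HodgeCM.Model.HypCensus HodgeCM.Model.SupplyInstance HodgeCM.Model.ArchSideTerm

namespace HodgeCM.Model

/-! ### § 2. The honest slots `k = 2, 3` along `twistU21 ∘ expP` (inputs `eR eS`, `Φ₂` only — the conjugated lines' sign facts are hypothesis-free) -/

section Slots

variable {L : CMField} {ι₁ : L →+* ℂ} (V : HermSpace3 L ι₁) (c : SeesawCtx L)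
variable
  (hGR : (cmSplittingDatum (L : Type) finProdFinEquiv (frameD V) (frameD_real V) (frameD_ne V) (dW c.D) (dW_real c.D)
    (dW_ne c.D)).CompatibleSplitting)
  (hGR₂ : (cmSplittingDatum (L : Type) (e₁) (frameD V) (frameD_real V) (frameD_ne V) (lineVec (L : Type) (dW' c.D 0))
    (fun _ => dW'_real c.D 0) (fun _ => dW'_ne c.D 0)).CompatibleSplitting)
  (hGR₃ : (cmSplittingDatum (L : Type) (e₁) (frameD V) (frameD_real V) (frameD_ne V) (lineVec (L : Type) (dW' c.D 1))
    (fun _ => dW'_real c.D 1) (fun _ => dW'_ne c.D 1)).CompatibleSplitting)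
  (η₂ η₃ : CMAdelic (L : Type) (frameD V) × CMAdelicOne (L : Type) →* ℂˣ)
  (Φ₂ : SchwartzMap ((Fin 3 × {v : {v : InfinitePlace ↥(maximalRealSubfield L) // v.IsReal} // v ≠ HypCensus.cmPlace (L : Type) ι₁}) → ℝ) ℂ)

/-! #### line 2 -/

section Two

variable
  (eR : PosIdx (cmXW (L : Type) (frameD V) (lineVec (L : Type) (dW' c.D 0)) (fun _ => dW'_real c.D 0) ι₁ (HypCensus.cmPlace (L : Type) ι₁)) ≃ Unit)
  (eS : NegIdx (cmXW (L : Type) (frameD V) (lineVec (L : Type) (dW' c.D 0)) (fun _ => dW'_real c.D 0) ι₁ (HypCensus.cmPlace (L : Type) ι₁)) ≃ Empty)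

/-- the intertwining `hτ` of the AN/REP bricks for `lineOmega_two` along `twistU21 ∘ expP`, `τ := F⁻¹` (record-free form of #W11
`archKTypeOfSlotTwo_hτG`). -/
theorem lineOmega_two_twistU21_expP_symm_applyG (b : Fin 2 → ℂ)
    (x : SchwartzMap (DPIdx (Fin 2) Unit Unit Empty ⊕
      (Fin 3 × {w : {w : InfinitePlace ↥(maximalRealSubfield L) // w.IsReal} // w ≠ HypCensus.cmPlace (L : Type) ι₁}) → ℝ) ℂ) :
    lineOmega_two V c.D hGR hGR₂ hGR₃ η₂ (twistU21 L ι₁ (BallForms.expP b))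
        (((cmBlockFrameAt (L : Type) e₁ (frameD V) (frameD_real V) (frameD_ne V) (lineVec (L : Type) (dW' c.D 0))
          (fun _ => dW'_real c.D 0) (fun _ => dW'_ne c.D 0) ι₁ (HypCensus.cmPlace (L : Type) ι₁) (blockPosEquiv V) (blockNegEquiv V) eR eS).symm :
            _ ≃L[ℂ] _) x) =
      ((cmBlockFrameAt (L : Type) e₁ (frameD V) (frameD_real V) (frameD_ne V) (lineVec (L : Type) (dW' c.D 0))
          (fun _ => dW'_real c.D 0) (fun _ => dW'_ne c.D 0) ι₁ (HypCensus.cmPlace (L : Type) ι₁) (blockPosEquiv V) (blockNegEquiv V) eR eS).symm :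
            _ ≃L[ℂ] _)
        (cmBlockRepAt (L : Type) e₁ (frameD V) (frameD_real V) (frameD_ne V) (lineVec (L : Type) (dW' c.D 0)) (fun _ => dW'_real c.D 0)
          (fun _ => dW'_ne c.D 0) hGR₂ ι₁ (HypCensus.cmPlace (L : Type) ι₁) (blockPosEquiv V) (blockNegEquiv V) eR eS
          (cmBlockSectionAt (L : Type) (frameD V) (frameD_real V) (frameD_ne V) (lineVec (L : Type) (dW' c.D 0))
            (fun _ => dW'_real c.D 0) (fun _ => dW'_ne c.D 0) ι₁ (HypCensus.cmPlace (L : Type) ι₁) (blockPosEquiv V) (blockNegEquiv V) eR eS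
            (((u21FrameEquiv (BallForms.expP b) : UForm (Fin 2) Unit), (1 : UForm Unit Empty)) : Ginf (Fin 2) Unit Unit Empty)) x) := by
  rw [lineOmega_two_twistU21_expP_AtG, cmArchWeilRep_cmBlockFrameAt_symm]

set_option backward.isDefEq.respectTransparency false in
/-- **(AN) for line 2 along `twistU21 ∘ expP`, record-free** (#W28 `isWeaklyPDiff_archKTypeOfSlotTwoRecG` minus the record). -/
theorem differentiableAt_lineOmega_two_twistU21_expPG
    (T : 𝓢((Fin 3 → mixedSpace (↥(maximalRealSubfield L))), ℂ) →L[ℂ] ℂ) (ℓ : Module.Dual ℂ (Fin 2 → ℂ)) :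
    DifferentiableAt ℝ (fun b => T (lineOmega_two V c.D hGR hGR₂ hGR₃ η₂ (twistU21 L ι₁ (BallForms.expP b))
      (blockFamilyOfAt (L : Type) e₁ (frameD V) (frameD_real V) (frameD_ne V) (lineVec (L : Type) (dW' c.D 0)) (fun _ => dW'_real c.D 0)
        (fun _ => dW'_ne c.D 0) ι₁ (blockPosEquiv V) (blockNegEquiv V) eR eS (degOnePDual Empty) Φ₂ ℓ))) 0 := by
  obtain ⟨ω₁, hW₁, hc₁⟩ := exists_isArchWeilDatum_lineSlot (R := Unit) (S := Empty)
  obtain ⟨ev₁, hvac₁⟩ := (junction (Fin 2) Unit Unit Empty).exists_vacExponents hW₁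
  exact ArchPair.differentiableAt_of_blockPair
    (fun b => lineOmega_two V c.D hGR hGR₂ hGR₃ η₂ (twistU21 L ι₁ (BallForms.expP b)))
    (blockFamilyOfAt (L : Type) e₁ (frameD V) (frameD_real V) (frameD_ne V) (lineVec (L : Type) (dW' c.D 0)) (fun _ => dW'_real c.D 0)
      (fun _ => dW'_ne c.D 0) ι₁ (blockPosEquiv V) (blockNegEquiv V) eR eS (degOnePDual Empty) Φ₂)
    (isArchWeilDatum_cmBlockAt (L : Type) e₁ (frameD V) (frameD_real V) (frameD_ne V) (lineVec (L : Type) (dW' c.D 0))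
      (fun _ => dW'_real c.D 0) (fun _ => dW'_ne c.D 0) hGR₂ ι₁ (HypCensus.cmPlace (L : Type) ι₁) (blockPosEquiv V) (blockNegEquiv V) eR eS
      (frameD_sign_ι₁' V) (line_hs₁W_of_real (dW'_real c.D 0) (dW'_ne c.D 0)) (frameD_sign_of_ne V) (fun τ hτ => line_hsW (dW' c.D 0) τ hτ))
    (continuous_cmBlockRepAt (L : Type) e₁ (frameD V) (frameD_real V) (frameD_ne V) (lineVec (L : Type) (dW' c.D 0))
      (fun _ => dW'_real c.D 0) (fun _ => dW'_ne c.D 0) hGR₂ ι₁ (HypCensus.cmPlace (L : Type) ι₁) (blockPosEquiv V) (blockNegEquiv V) eR eS)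
    hW₁ hc₁ hvac₁
    (cmBlockSectionAt (L : Type) (frameD V) (frameD_real V) (frameD_ne V) (lineVec (L : Type) (dW' c.D 0)) (fun _ => dW'_real c.D 0)
      (fun _ => dW'_ne c.D 0) ι₁ (HypCensus.cmPlace (L : Type) ι₁) (blockPosEquiv V) (blockNegEquiv V) eR eS)
    (continuous_cmBlockSectionAt (L : Type) (frameD V) (frameD_real V) (frameD_ne V) (lineVec (L : Type) (dW' c.D 0))
      (fun _ => dW'_real c.D 0) (fun _ => dW'_ne c.D 0) ι₁ (HypCensus.cmPlace (L : Type) ι₁) (blockPosEquiv V) (blockNegEquiv V) eR eS)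
    (coe_cmBlockPhaseHomAt_cmBlockSectionAt (L : Type) e₁ (frameD V) (frameD_real V) (frameD_ne V) (lineVec (L : Type) (dW' c.D 0))
      (fun _ => dW'_real c.D 0) (fun _ => dW'_ne c.D 0) ι₁ (HypCensus.cmPlace (L : Type) ι₁) (blockPosEquiv V) (blockNegEquiv V) eR eS)
    ((cmBlockFrameAt (L : Type) e₁ (frameD V) (frameD_real V) (frameD_ne V) (lineVec (L : Type) (dW' c.D 0)) (fun _ => dW'_real c.D 0)
      (fun _ => dW'_ne c.D 0) ι₁ (HypCensus.cmPlace (L : Type) ι₁) (blockPosEquiv V) (blockNegEquiv V) eR eS).symm.toContinuousLinearMap)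
    (lineOmega_two_twistU21_expP_symm_applyG V c hGR hGR₂ hGR₃ η₂ eR eS)
    Φ₂ (degOnePDual Empty) (fun _ => rfl) T ℓ

set_option backward.isDefEq.respectTransparency false in
/-- **(REP) for line 2 along `twistU21 ∘ expP` and `-i e_p`, record-free** (#W28 `isPMinusKilledAlong_archKTypeOfSlotTwoRec_twistG` minus the
record). -/
theorem pMinus_lineOmega_two_twistU21_expPG (p : Fin 2) (ℓ : Module.Dual ℂ (Fin 2 → ℂ)) :
    ∃ D Dᵢ : 𝓢((Fin 3 → mixedSpace (↥(maximalRealSubfield L))), ℂ),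
      Tendsto (fun t : ℝ => t⁻¹ • (lineOmega_two V c.D hGR hGR₂ hGR₃ η₂
          (twistU21 L ι₁ (BallForms.expP (t • (-Complex.I • (Pi.single p 1 : Fin 2 → ℂ)))))
          (blockFamilyOfAt (L : Type) e₁ (frameD V) (frameD_real V) (frameD_ne V) (lineVec (L : Type) (dW' c.D 0)) (fun _ => dW'_real c.D 0)
            (fun _ => dW'_ne c.D 0) ι₁ (blockPosEquiv V) (blockNegEquiv V) eR eS (degOnePDual Empty) Φ₂ ℓ) -
          blockFamilyOfAt (L : Type) e₁ (frameD V) (frameD_real V) (frameD_ne V) (lineVec (L : Type) (dW' c.D 0)) (fun _ => dW'_real c.D 0)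
            (fun _ => dW'_ne c.D 0) ι₁ (blockPosEquiv V) (blockNegEquiv V) eR eS (degOnePDual Empty) Φ₂ ℓ)) (𝓝[≠] 0) (𝓝 D) ∧
      Tendsto (fun t : ℝ => t⁻¹ • (lineOmega_two V c.D hGR hGR₂ hGR₃ η₂
          (twistU21 L ι₁ (BallForms.expP (t • (Complex.I • (-Complex.I • (Pi.single p 1 : Fin 2 → ℂ))))))
          (blockFamilyOfAt (L : Type) e₁ (frameD V) (frameD_real V) (frameD_ne V) (lineVec (L : Type) (dW' c.D 0)) (fun _ => dW'_real c.D 0)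
            (fun _ => dW'_ne c.D 0) ι₁ (blockPosEquiv V) (blockNegEquiv V) eR eS (degOnePDual Empty) Φ₂ ℓ) -
          blockFamilyOfAt (L : Type) e₁ (frameD V) (frameD_real V) (frameD_ne V) (lineVec (L : Type) (dW' c.D 0)) (fun _ => dW'_real c.D 0)
            (fun _ => dW'_ne c.D 0) ι₁ (blockPosEquiv V) (blockNegEquiv V) eR eS (degOnePDual Empty) Φ₂ ℓ)) (𝓝[≠] 0) (𝓝 Dᵢ) ∧
      D + Complex.I • Dᵢ = 0 := by
  obtain ⟨ω₁, hW₁, hc₁⟩ := exists_isArchWeilDatum_lineSlot (R := Unit) (S := Empty)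
  exact ArchPair.pMinus_of_blockPair
    (fun b => lineOmega_two V c.D hGR hGR₂ hGR₃ η₂ (twistU21 L ι₁ (BallForms.expP b)))
    (blockFamilyOfAt (L : Type) e₁ (frameD V) (frameD_real V) (frameD_ne V) (lineVec (L : Type) (dW' c.D 0)) (fun _ => dW'_real c.D 0)
      (fun _ => dW'_ne c.D 0) ι₁ (blockPosEquiv V) (blockNegEquiv V) eR eS (degOnePDual Empty) Φ₂)
    (isArchWeilDatum_cmBlockAt (L : Type) e₁ (frameD V) (frameD_real V) (frameD_ne V) (lineVec (L : Type) (dW' c.D 0))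
      (fun _ => dW'_real c.D 0) (fun _ => dW'_ne c.D 0) hGR₂ ι₁ (HypCensus.cmPlace (L : Type) ι₁) (blockPosEquiv V) (blockNegEquiv V) eR eS
      (frameD_sign_ι₁' V) (line_hs₁W_of_real (dW'_real c.D 0) (dW'_ne c.D 0)) (frameD_sign_of_ne V) (fun τ hτ => line_hsW (dW' c.D 0) τ hτ))
    (continuous_cmBlockRepAt (L : Type) e₁ (frameD V) (frameD_real V) (frameD_ne V) (lineVec (L : Type) (dW' c.D 0))
      (fun _ => dW'_real c.D 0) (fun _ => dW'_ne c.D 0) hGR₂ ι₁ (HypCensus.cmPlace (L : Type) ι₁) (blockPosEquiv V) (blockNegEquiv V) eR eS)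
    hW₁ hc₁
    (cmBlockSectionAt (L : Type) (frameD V) (frameD_real V) (frameD_ne V) (lineVec (L : Type) (dW' c.D 0)) (fun _ => dW'_real c.D 0)
      (fun _ => dW'_ne c.D 0) ι₁ (HypCensus.cmPlace (L : Type) ι₁) (blockPosEquiv V) (blockNegEquiv V) eR eS)
    (continuous_cmBlockSectionAt (L : Type) (frameD V) (frameD_real V) (frameD_ne V) (lineVec (L : Type) (dW' c.D 0))
      (fun _ => dW'_real c.D 0) (fun _ => dW'_ne c.D 0) ι₁ (HypCensus.cmPlace (L : Type) ι₁) (blockPosEquiv V) (blockNegEquiv V) eR eS)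
    (coe_cmBlockPhaseHomAt_cmBlockSectionAt (L : Type) e₁ (frameD V) (frameD_real V) (frameD_ne V) (lineVec (L : Type) (dW' c.D 0))
      (fun _ => dW'_real c.D 0) (fun _ => dW'_ne c.D 0) ι₁ (HypCensus.cmPlace (L : Type) ι₁) (blockPosEquiv V) (blockNegEquiv V) eR eS)
    ((cmBlockFrameAt (L : Type) e₁ (frameD V) (frameD_real V) (frameD_ne V) (lineVec (L : Type) (dW' c.D 0)) (fun _ => dW'_real c.D 0)
      (fun _ => dW'_ne c.D 0) ι₁ (HypCensus.cmPlace (L : Type) ι₁) (blockPosEquiv V) (blockNegEquiv V) eR eS).symm.toContinuousLinearMap)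
    (lineOmega_two_twistU21_expP_symm_applyG V c hGR hGR₂ hGR₃ η₂ eR eS)
    Φ₂ (degOnePDual Empty) (fun _ => rfl) (hypOpGen_add_I_smul_rotBoostGen_degOnePDual Empty) p ℓ

/-! ##### § 3 (line 2): at `expP` with the canonical representative — (a4) `hd`, the `𝔭₋`-limits, (a5) `hCR` -/

/-- **(a4) for line 2 — `hd` of sinst-1's #1259, record-free**: `b ↦ T (lineOmega_two … (expP b) (Φ_∞,2(ℓ)))` is real-differentiable at `0`
(canonical representative `hemb`: `twistU21 = id`). -/
theorem hd_lineOmega_twoG (hemb : (InfinitePlace.mk ι₁).embedding = ι₁)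
    (T : 𝓢((Fin 3 → mixedSpace (↥(maximalRealSubfield L))), ℂ) →L[ℂ] ℂ) (ℓ : Module.Dual ℂ (Fin 2 → ℂ)) :
    DifferentiableAt ℝ (fun b => T (lineOmega_two V c.D hGR hGR₂ hGR₃ η₂ (BallForms.expP b)
      (blockFamilyOfAt (L : Type) e₁ (frameD V) (frameD_real V) (frameD_ne V) (lineVec (L : Type) (dW' c.D 0)) (fun _ => dW'_real c.D 0)
        (fun _ => dW'_ne c.D 0) ι₁ (blockPosEquiv V) (blockNegEquiv V) eR eS (degOnePDual Empty) Φ₂ ℓ))) 0 := by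
  have h := differentiableAt_lineOmega_two_twistU21_expPG V c hGR hGR₂ hGR₃ η₂ Φ₂ eR eS T ℓ
  simp only [twistU21_eq_self_of_embedding_eq hemb] at h
  exact h

/-- the `𝔭₋`-limits of line 2 at `expP` along `-i e_p` (row 15 `hk` in the END-STATE shape, record-free). -/
theorem pMinus_lineOmega_twoG (hemb : (InfinitePlace.mk ι₁).embedding = ι₁) (p : Fin 2) (ℓ : Module.Dual ℂ (Fin 2 → ℂ)) :
    ∃ D Dᵢ : 𝓢((Fin 3 → mixedSpace (↥(maximalRealSubfield L))), ℂ),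
      Tendsto (fun t : ℝ => t⁻¹ • (lineOmega_two V c.D hGR hGR₂ hGR₃ η₂
          (BallForms.expP (t • (-Complex.I • (Pi.single p 1 : Fin 2 → ℂ))))
          (blockFamilyOfAt (L : Type) e₁ (frameD V) (frameD_real V) (frameD_ne V) (lineVec (L : Type) (dW' c.D 0)) (fun _ => dW'_real c.D 0)
            (fun _ => dW'_ne c.D 0) ι₁ (blockPosEquiv V) (blockNegEquiv V) eR eS (degOnePDual Empty) Φ₂ ℓ) -
          blockFamilyOfAt (L : Type) e₁ (frameD V) (frameD_real V) (frameD_ne V) (lineVec (L : Type) (dW' c.D 0)) (fun _ => dW'_real c.D 0)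
            (fun _ => dW'_ne c.D 0) ι₁ (blockPosEquiv V) (blockNegEquiv V) eR eS (degOnePDual Empty) Φ₂ ℓ)) (𝓝[≠] 0) (𝓝 D) ∧
      Tendsto (fun t : ℝ => t⁻¹ • (lineOmega_two V c.D hGR hGR₂ hGR₃ η₂
          (BallForms.expP (t • (Complex.I • (-Complex.I • (Pi.single p 1 : Fin 2 → ℂ)))))
          (blockFamilyOfAt (L : Type) e₁ (frameD V) (frameD_real V) (frameD_ne V) (lineVec (L : Type) (dW' c.D 0)) (fun _ => dW'_real c.D 0)
            (fun _ => dW'_ne c.D 0) ι₁ (blockPosEquiv V) (blockNegEquiv V) eR eS (degOnePDual Empty) Φ₂ ℓ) -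
          blockFamilyOfAt (L : Type) e₁ (frameD V) (frameD_real V) (frameD_ne V) (lineVec (L : Type) (dW' c.D 0)) (fun _ => dW'_real c.D 0)
            (fun _ => dW'_ne c.D 0) ι₁ (blockPosEquiv V) (blockNegEquiv V) eR eS (degOnePDual Empty) Φ₂ ℓ)) (𝓝[≠] 0) (𝓝 Dᵢ) ∧
      D + Complex.I • Dᵢ = 0 := by
  have h := pMinus_lineOmega_two_twistU21_expPG V c hGR hGR₂ hGR₃ η₂ Φ₂ eR eS p ℓ
  simp only [twistU21_eq_self_of_embedding_eq hemb] at h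
  exact h

/-- **(a5) for line 2 — `hCR` of sinst-1's #1259, record-free**: the scalarised differential at `0` of
`b ↦ T (lineOmega_two … (expP b) (Φ_∞,2(ℓ)))` is complex-linear (record-free twin of `ThetaHolDirections.isWeaklyCR_of_isPMinusKilledAlong`,
`c p := -i`). -/
theorem hCR_lineOmega_twoG (hemb : (InfinitePlace.mk ι₁).embedding = ι₁)
    (T : 𝓢((Fin 3 → mixedSpace (↥(maximalRealSubfield L))), ℂ) →L[ℂ] ℂ) (ℓ : Module.Dual ℂ (Fin 2 → ℂ)) (v : Fin 2 → ℂ) :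
    fderiv ℝ (fun b => T (lineOmega_two V c.D hGR hGR₂ hGR₃ η₂ (BallForms.expP b)
        (blockFamilyOfAt (L : Type) e₁ (frameD V) (frameD_real V) (frameD_ne V) (lineVec (L : Type) (dW' c.D 0)) (fun _ => dW'_real c.D 0)
          (fun _ => dW'_ne c.D 0) ι₁ (blockPosEquiv V) (blockNegEquiv V) eR eS (degOnePDual Empty) Φ₂ ℓ))) 0 (Complex.I • v) =
      Complex.I • fderiv ℝ (fun b => T (lineOmega_two V c.D hGR hGR₂ hGR₃ η₂ (BallForms.expP b)
        (blockFamilyOfAt (L : Type) e₁ (frameD V) (frameD_real V) (frameD_ne V) (lineVec (L : Type) (dW' c.D 0)) (fun _ => dW'_real c.D 0)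
          (fun _ => dW'_ne c.D 0) ι₁ (blockPosEquiv V) (blockNegEquiv V) eR eS (degOnePDual Empty) Φ₂ ℓ))) 0 v := by
  have h0 : lineOmega_two V c.D hGR hGR₂ hGR₃ η₂ (BallForms.expP 0)
      (blockFamilyOfAt (L : Type) e₁ (frameD V) (frameD_real V) (frameD_ne V) (lineVec (L : Type) (dW' c.D 0)) (fun _ => dW'_real c.D 0)
        (fun _ => dW'_ne c.D 0) ι₁ (blockPosEquiv V) (blockNegEquiv V) eR eS (degOnePDual Empty) Φ₂ ℓ) =
      blockFamilyOfAt (L : Type) e₁ (frameD V) (frameD_real V) (frameD_ne V) (lineVec (L : Type) (dW' c.D 0)) (fun _ => dW'_real c.D 0)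
        (fun _ => dW'_ne c.D 0) ι₁ (blockPosEquiv V) (blockNegEquiv V) eR eS (degOnePDual Empty) Φ₂ ℓ := by
    rw [BallForms.expP_zero, map_one, Module.End.one_apply]
  refine ThetaHolDirections.apply_I_smul_of_basis
    ((fderiv ℝ (fun b => T (lineOmega_two V c.D hGR hGR₂ hGR₃ η₂ (BallForms.expP b)
      (blockFamilyOfAt (L : Type) e₁ (frameD V) (frameD_real V) (frameD_ne V) (lineVec (L : Type) (dW' c.D 0)) (fun _ => dW'_real c.D 0)
        (fun _ => dW'_ne c.D 0) ι₁ (blockPosEquiv V) (blockNegEquiv V) eR eS (degOnePDual Empty) Φ₂ ℓ))) 0).toLinearMap)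
    (fun _ => -Complex.I) (fun _ => neg_ne_zero.2 Complex.I_ne_zero) (fun p => ?_) v
  obtain ⟨D, Dᵢ, hD, hDᵢ, hsum⟩ := pMinus_lineOmega_twoG V c hGR hGR₂ hGR₃ η₂ Φ₂ eR eS hemb p ℓ
  exact ThetaHolAssembly.fderiv_I_smul_of_slopes T
    (Ψ := fun b => lineOmega_two V c.D hGR hGR₂ hGR₃ η₂ (BallForms.expP b)
      (blockFamilyOfAt (L : Type) e₁ (frameD V) (frameD_real V) (frameD_ne V) (lineVec (L : Type) (dW' c.D 0)) (fun _ => dW'_real c.D 0)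
        (fun _ => dW'_ne c.D 0) ι₁ (blockPosEquiv V) (blockNegEquiv V) eR eS (degOnePDual Empty) Φ₂ ℓ))
    (hd_lineOmega_twoG V c hGR hGR₂ hGR₃ η₂ Φ₂ eR eS hemb T ℓ) _
    (by simpa only [h0] using hD) (by simpa only [h0] using hDᵢ) hsum

end Two

/-! #### line 3 -/

section Three

variable
  (eR : PosIdx (cmXW (L : Type) (frameD V) (lineVec (L : Type) (dW' c.D 1)) (fun _ => dW'_real c.D 1) ι₁ (HypCensus.cmPlace (L : Type) ι₁)) ≃ Unit)
  (eS : NegIdx (cmXW (L : Type) (frameD V) (lineVec (L : Type) (dW' c.D 1)) (fun _ => dW'_real c.D 1) ι₁ (HypCensus.cmPlace (L : Type) ι₁)) ≃ Empty)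

/-- the intertwining `hτ` of the AN/REP bricks for `lineOmega_three` along `twistU21 ∘ expP`, `τ := F⁻¹` (record-free form of #W11
`archKTypeOfSlotThree_hτG`). -/
theorem lineOmega_three_twistU21_expP_symm_applyG (b : Fin 2 → ℂ)
    (x : SchwartzMap (DPIdx (Fin 2) Unit Unit Empty ⊕
      (Fin 3 × {w : {w : InfinitePlace ↥(maximalRealSubfield L) // w.IsReal} // w ≠ HypCensus.cmPlace (L : Type) ι₁}) → ℝ) ℂ) :
    lineOmega_three V c.D hGR hGR₂ hGR₃ η₃ (twistU21 L ι₁ (BallForms.expP b))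
        (((cmBlockFrameAt (L : Type) e₁ (frameD V) (frameD_real V) (frameD_ne V) (lineVec (L : Type) (dW' c.D 1))
          (fun _ => dW'_real c.D 1) (fun _ => dW'_ne c.D 1) ι₁ (HypCensus.cmPlace (L : Type) ι₁) (blockPosEquiv V) (blockNegEquiv V) eR eS).symm :
            _ ≃L[ℂ] _) x) =
      ((cmBlockFrameAt (L : Type) e₁ (frameD V) (frameD_real V) (frameD_ne V) (lineVec (L : Type) (dW' c.D 1))
          (fun _ => dW'_real c.D 1) (fun _ => dW'_ne c.D 1) ι₁ (HypCensus.cmPlace (L : Type) ι₁) (blockPosEquiv V) (blockNegEquiv V) eR eS).symm :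
            _ ≃L[ℂ] _)
        (cmBlockRepAt (L : Type) e₁ (frameD V) (frameD_real V) (frameD_ne V) (lineVec (L : Type) (dW' c.D 1)) (fun _ => dW'_real c.D 1)
          (fun _ => dW'_ne c.D 1) hGR₃ ι₁ (HypCensus.cmPlace (L : Type) ι₁) (blockPosEquiv V) (blockNegEquiv V) eR eS
          (cmBlockSectionAt (L : Type) (frameD V) (frameD_real V) (frameD_ne V) (lineVec (L : Type) (dW' c.D 1))
            (fun _ => dW'_real c.D 1) (fun _ => dW'_ne c.D 1) ι₁ (HypCensus.cmPlace (L : Type) ι₁) (blockPosEquiv V) (blockNegEquiv V) eR eS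
            (((u21FrameEquiv (BallForms.expP b) : UForm (Fin 2) Unit), (1 : UForm Unit Empty)) : Ginf (Fin 2) Unit Unit Empty)) x) := by
  rw [lineOmega_three_twistU21_expP_AtG, cmArchWeilRep_cmBlockFrameAt_symm]

set_option backward.isDefEq.respectTransparency false in
/-- **(AN) for line 3 along `twistU21 ∘ expP`, record-free** (#W28 `isWeaklyPDiff_archKTypeOfSlotThreeRecG` minus the record). -/
theorem differentiableAt_lineOmega_three_twistU21_expPG
    (T : 𝓢((Fin 3 → mixedSpace (↥(maximalRealSubfield L))), ℂ) →L[ℂ] ℂ) (ℓ : Module.Dual ℂ (Fin 2 → ℂ)) :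
    DifferentiableAt ℝ (fun b => T (lineOmega_three V c.D hGR hGR₂ hGR₃ η₃ (twistU21 L ι₁ (BallForms.expP b))
      (blockFamilyOfAt (L : Type) e₁ (frameD V) (frameD_real V) (frameD_ne V) (lineVec (L : Type) (dW' c.D 1)) (fun _ => dW'_real c.D 1)
        (fun _ => dW'_ne c.D 1) ι₁ (blockPosEquiv V) (blockNegEquiv V) eR eS (degOnePDual Empty) Φ₂ ℓ))) 0 := by
  obtain ⟨ω₁, hW₁, hc₁⟩ := exists_isArchWeilDatum_lineSlot (R := Unit) (S := Empty)
  obtain ⟨ev₁, hvac₁⟩ := (junction (Fin 2) Unit Unit Empty).exists_vacExponents hW₁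
  exact ArchPair.differentiableAt_of_blockPair
    (fun b => lineOmega_three V c.D hGR hGR₂ hGR₃ η₃ (twistU21 L ι₁ (BallForms.expP b)))
    (blockFamilyOfAt (L : Type) e₁ (frameD V) (frameD_real V) (frameD_ne V) (lineVec (L : Type) (dW' c.D 1)) (fun _ => dW'_real c.D 1)
      (fun _ => dW'_ne c.D 1) ι₁ (blockPosEquiv V) (blockNegEquiv V) eR eS (degOnePDual Empty) Φ₂)
    (isArchWeilDatum_cmBlockAt (L : Type) e₁ (frameD V) (frameD_real V) (frameD_ne V) (lineVec (L : Type) (dW' c.D 1))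
      (fun _ => dW'_real c.D 1) (fun _ => dW'_ne c.D 1) hGR₃ ι₁ (HypCensus.cmPlace (L : Type) ι₁) (blockPosEquiv V) (blockNegEquiv V) eR eS
      (frameD_sign_ι₁' V) (line_hs₁W_of_real (dW'_real c.D 1) (dW'_ne c.D 1)) (frameD_sign_of_ne V) (fun τ hτ => line_hsW (dW' c.D 1) τ hτ))
    (continuous_cmBlockRepAt (L : Type) e₁ (frameD V) (frameD_real V) (frameD_ne V) (lineVec (L : Type) (dW' c.D 1))
      (fun _ => dW'_real c.D 1) (fun _ => dW'_ne c.D 1) hGR₃ ι₁ (HypCensus.cmPlace (L : Type) ι₁) (blockPosEquiv V) (blockNegEquiv V) eR eS)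
    hW₁ hc₁ hvac₁
    (cmBlockSectionAt (L : Type) (frameD V) (frameD_real V) (frameD_ne V) (lineVec (L : Type) (dW' c.D 1)) (fun _ => dW'_real c.D 1)
      (fun _ => dW'_ne c.D 1) ι₁ (HypCensus.cmPlace (L : Type) ι₁) (blockPosEquiv V) (blockNegEquiv V) eR eS)
    (continuous_cmBlockSectionAt (L : Type) (frameD V) (frameD_real V) (frameD_ne V) (lineVec (L : Type) (dW' c.D 1))
      (fun _ => dW'_real c.D 1) (fun _ => dW'_ne c.D 1) ι₁ (HypCensus.cmPlace (L : Type) ι₁) (blockPosEquiv V) (blockNegEquiv V) eR eS)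
    (coe_cmBlockPhaseHomAt_cmBlockSectionAt (L : Type) e₁ (frameD V) (frameD_real V) (frameD_ne V) (lineVec (L : Type) (dW' c.D 1))
      (fun _ => dW'_real c.D 1) (fun _ => dW'_ne c.D 1) ι₁ (HypCensus.cmPlace (L : Type) ι₁) (blockPosEquiv V) (blockNegEquiv V) eR eS)
    ((cmBlockFrameAt (L : Type) e₁ (frameD V) (frameD_real V) (frameD_ne V) (lineVec (L : Type) (dW' c.D 1)) (fun _ => dW'_real c.D 1)
      (fun _ => dW'_ne c.D 1) ι₁ (HypCensus.cmPlace (L : Type) ι₁) (blockPosEquiv V) (blockNegEquiv V) eR eS).symm.toContinuousLinearMap)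
    (lineOmega_three_twistU21_expP_symm_applyG V c hGR hGR₂ hGR₃ η₃ eR eS)
    Φ₂ (degOnePDual Empty) (fun _ => rfl) T ℓ

set_option backward.isDefEq.respectTransparency false in
/-- **(REP) for line 3 along `twistU21 ∘ expP` and `-i e_p`, record-free** (#W28 `isPMinusKilledAlong_archKTypeOfSlotThreeRec_twistG` minus the
record). -/
theorem pMinus_lineOmega_three_twistU21_expPG (p : Fin 2) (ℓ : Module.Dual ℂ (Fin 2 → ℂ)) :
    ∃ D Dᵢ : 𝓢((Fin 3 → mixedSpace (↥(maximalRealSubfield L))), ℂ),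
      Tendsto (fun t : ℝ => t⁻¹ • (lineOmega_three V c.D hGR hGR₂ hGR₃ η₃
          (twistU21 L ι₁ (BallForms.expP (t • (-Complex.I • (Pi.single p 1 : Fin 2 → ℂ)))))
          (blockFamilyOfAt (L : Type) e₁ (frameD V) (frameD_real V) (frameD_ne V) (lineVec (L : Type) (dW' c.D 1)) (fun _ => dW'_real c.D 1)
            (fun _ => dW'_ne c.D 1) ι₁ (blockPosEquiv V) (blockNegEquiv V) eR eS (degOnePDual Empty) Φ₂ ℓ) -
          blockFamilyOfAt (L : Type) e₁ (frameD V) (frameD_real V) (frameD_ne V) (lineVec (L : Type) (dW' c.D 1)) (fun _ => dW'_real c.D 1)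
            (fun _ => dW'_ne c.D 1) ι₁ (blockPosEquiv V) (blockNegEquiv V) eR eS (degOnePDual Empty) Φ₂ ℓ)) (𝓝[≠] 0) (𝓝 D) ∧
      Tendsto (fun t : ℝ => t⁻¹ • (lineOmega_three V c.D hGR hGR₂ hGR₃ η₃
          (twistU21 L ι₁ (BallForms.expP (t • (Complex.I • (-Complex.I • (Pi.single p 1 : Fin 2 → ℂ))))))
          (blockFamilyOfAt (L : Type) e₁ (frameD V) (frameD_real V) (frameD_ne V) (lineVec (L : Type) (dW' c.D 1)) (fun _ => dW'_real c.D 1)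
            (fun _ => dW'_ne c.D 1) ι₁ (blockPosEquiv V) (blockNegEquiv V) eR eS (degOnePDual Empty) Φ₂ ℓ) -
          blockFamilyOfAt (L : Type) e₁ (frameD V) (frameD_real V) (frameD_ne V) (lineVec (L : Type) (dW' c.D 1)) (fun _ => dW'_real c.D 1)
            (fun _ => dW'_ne c.D 1) ι₁ (blockPosEquiv V) (blockNegEquiv V) eR eS (degOnePDual Empty) Φ₂ ℓ)) (𝓝[≠] 0) (𝓝 Dᵢ) ∧
      D + Complex.I • Dᵢ = 0 := by
  obtain ⟨ω₁, hW₁, hc₁⟩ := exists_isArchWeilDatum_lineSlot (R := Unit) (S := Empty)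
  exact ArchPair.pMinus_of_blockPair
    (fun b => lineOmega_three V c.D hGR hGR₂ hGR₃ η₃ (twistU21 L ι₁ (BallForms.expP b)))
    (blockFamilyOfAt (L : Type) e₁ (frameD V) (frameD_real V) (frameD_ne V) (lineVec (L : Type) (dW' c.D 1)) (fun _ => dW'_real c.D 1)
      (fun _ => dW'_ne c.D 1) ι₁ (blockPosEquiv V) (blockNegEquiv V) eR eS (degOnePDual Empty) Φ₂)
    (isArchWeilDatum_cmBlockAt (L : Type) e₁ (frameD V) (frameD_real V) (frameD_ne V) (lineVec (L : Type) (dW' c.D 1))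
      (fun _ => dW'_real c.D 1) (fun _ => dW'_ne c.D 1) hGR₃ ι₁ (HypCensus.cmPlace (L : Type) ι₁) (blockPosEquiv V) (blockNegEquiv V) eR eS
      (frameD_sign_ι₁' V) (line_hs₁W_of_real (dW'_real c.D 1) (dW'_ne c.D 1)) (frameD_sign_of_ne V) (fun τ hτ => line_hsW (dW' c.D 1) τ hτ))
    (continuous_cmBlockRepAt (L : Type) e₁ (frameD V) (frameD_real V) (frameD_ne V) (lineVec (L : Type) (dW' c.D 1))
      (fun _ => dW'_real c.D 1) (fun _ => dW'_ne c.D 1) hGR₃ ι₁ (HypCensus.cmPlace (L : Type) ι₁) (blockPosEquiv V) (blockNegEquiv V) eR eS)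
    hW₁ hc₁
    (cmBlockSectionAt (L : Type) (frameD V) (frameD_real V) (frameD_ne V) (lineVec (L : Type) (dW' c.D 1)) (fun _ => dW'_real c.D 1)
      (fun _ => dW'_ne c.D 1) ι₁ (HypCensus.cmPlace (L : Type) ι₁) (blockPosEquiv V) (blockNegEquiv V) eR eS)
    (continuous_cmBlockSectionAt (L : Type) (frameD V) (frameD_real V) (frameD_ne V) (lineVec (L : Type) (dW' c.D 1))
      (fun _ => dW'_real c.D 1) (fun _ => dW'_ne c.D 1) ι₁ (HypCensus.cmPlace (L : Type) ι₁) (blockPosEquiv V) (blockNegEquiv V) eR eS)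
    (coe_cmBlockPhaseHomAt_cmBlockSectionAt (L : Type) e₁ (frameD V) (frameD_real V) (frameD_ne V) (lineVec (L : Type) (dW' c.D 1))
      (fun _ => dW'_real c.D 1) (fun _ => dW'_ne c.D 1) ι₁ (HypCensus.cmPlace (L : Type) ι₁) (blockPosEquiv V) (blockNegEquiv V) eR eS)
    ((cmBlockFrameAt (L : Type) e₁ (frameD V) (frameD_real V) (frameD_ne V) (lineVec (L : Type) (dW' c.D 1)) (fun _ => dW'_real c.D 1)
      (fun _ => dW'_ne c.D 1) ι₁ (HypCensus.cmPlace (L : Type) ι₁) (blockPosEquiv V) (blockNegEquiv V) eR eS).symm.toContinuousLinearMap)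
    (lineOmega_three_twistU21_expP_symm_applyG V c hGR hGR₂ hGR₃ η₃ eR eS)
    Φ₂ (degOnePDual Empty) (fun _ => rfl) (hypOpGen_add_I_smul_rotBoostGen_degOnePDual Empty) p ℓ

/-! ##### § 3 (line 3): at `expP` with the canonical representative — (a4) `hd`, the `𝔭₋`-limits, (a5) `hCR` -/

/-- **(a4) for line 3 — `hd` of sinst-1's #1259, record-free**: `b ↦ T (lineOmega_three … (expP b) (Φ_∞,3(ℓ)))` is real-differentiable at `0`
(canonical representative `hemb`: `twistU21 = id`). -/
theorem hd_lineOmega_threeG (hemb : (InfinitePlace.mk ι₁).embedding = ι₁)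
    (T : 𝓢((Fin 3 → mixedSpace (↥(maximalRealSubfield L))), ℂ) →L[ℂ] ℂ) (ℓ : Module.Dual ℂ (Fin 2 → ℂ)) :
    DifferentiableAt ℝ (fun b => T (lineOmega_three V c.D hGR hGR₂ hGR₃ η₃ (BallForms.expP b)
      (blockFamilyOfAt (L : Type) e₁ (frameD V) (frameD_real V) (frameD_ne V) (lineVec (L : Type) (dW' c.D 1)) (fun _ => dW'_real c.D 1)
        (fun _ => dW'_ne c.D 1) ι₁ (blockPosEquiv V) (blockNegEquiv V) eR eS (degOnePDual Empty) Φ₂ ℓ))) 0 := by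
  have h := differentiableAt_lineOmega_three_twistU21_expPG V c hGR hGR₂ hGR₃ η₃ Φ₂ eR eS T ℓ
  simp only [twistU21_eq_self_of_embedding_eq hemb] at h
  exact h

/-- the `𝔭₋`-limits of line 3 at `expP` along `-i e_p` (row 15 `hk` in the END-STATE shape, record-free). -/
theorem pMinus_lineOmega_threeG (hemb : (InfinitePlace.mk ι₁).embedding = ι₁) (p : Fin 2) (ℓ : Module.Dual ℂ (Fin 2 → ℂ)) :
    ∃ D Dᵢ : 𝓢((Fin 3 → mixedSpace (↥(maximalRealSubfield L))), ℂ),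
      Tendsto (fun t : ℝ => t⁻¹ • (lineOmega_three V c.D hGR hGR₂ hGR₃ η₃
          (BallForms.expP (t • (-Complex.I • (Pi.single p 1 : Fin 2 → ℂ))))
          (blockFamilyOfAt (L : Type) e₁ (frameD V) (frameD_real V) (frameD_ne V) (lineVec (L : Type) (dW' c.D 1)) (fun _ => dW'_real c.D 1)
            (fun _ => dW'_ne c.D 1) ι₁ (blockPosEquiv V) (blockNegEquiv V) eR eS (degOnePDual Empty) Φ₂ ℓ) -
          blockFamilyOfAt (L : Type) e₁ (frameD V) (frameD_real V) (frameD_ne V) (lineVec (L : Type) (dW' c.D 1)) (fun _ => dW'_real c.D 1)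
            (fun _ => dW'_ne c.D 1) ι₁ (blockPosEquiv V) (blockNegEquiv V) eR eS (degOnePDual Empty) Φ₂ ℓ)) (𝓝[≠] 0) (𝓝 D) ∧
      Tendsto (fun t : ℝ => t⁻¹ • (lineOmega_three V c.D hGR hGR₂ hGR₃ η₃
          (BallForms.expP (t • (Complex.I • (-Complex.I • (Pi.single p 1 : Fin 2 → ℂ)))))
          (blockFamilyOfAt (L : Type) e₁ (frameD V) (frameD_real V) (frameD_ne V) (lineVec (L : Type) (dW' c.D 1)) (fun _ => dW'_real c.D 1)
            (fun _ => dW'_ne c.D 1) ι₁ (blockPosEquiv V) (blockNegEquiv V) eR eS (degOnePDual Empty) Φ₂ ℓ) -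
          blockFamilyOfAt (L : Type) e₁ (frameD V) (frameD_real V) (frameD_ne V) (lineVec (L : Type) (dW' c.D 1)) (fun _ => dW'_real c.D 1)
            (fun _ => dW'_ne c.D 1) ι₁ (blockPosEquiv V) (blockNegEquiv V) eR eS (degOnePDual Empty) Φ₂ ℓ)) (𝓝[≠] 0) (𝓝 Dᵢ) ∧
      D + Complex.I • Dᵢ = 0 := by
  have h := pMinus_lineOmega_three_twistU21_expPG V c hGR hGR₂ hGR₃ η₃ Φ₂ eR eS p ℓ
  simp only [twistU21_eq_self_of_embedding_eq hemb] at h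
  exact h

/-- **(a5) for line 3 — `hCR` of sinst-1's #1259, record-free**: the scalarised differential at `0` of
`b ↦ T (lineOmega_three … (expP b) (Φ_∞,3(ℓ)))` is complex-linear (record-free twin of `ThetaHolDirections.isWeaklyCR_of_isPMinusKilledAlong`,
`c p := -i`). -/
theorem hCR_lineOmega_threeG (hemb : (InfinitePlace.mk ι₁).embedding = ι₁)
    (T : 𝓢((Fin 3 → mixedSpace (↥(maximalRealSubfield L))), ℂ) →L[ℂ] ℂ) (ℓ : Module.Dual ℂ (Fin 2 → ℂ)) (v : Fin 2 → ℂ) :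
    fderiv ℝ (fun b => T (lineOmega_three V c.D hGR hGR₂ hGR₃ η₃ (BallForms.expP b)
        (blockFamilyOfAt (L : Type) e₁ (frameD V) (frameD_real V) (frameD_ne V) (lineVec (L : Type) (dW' c.D 1)) (fun _ => dW'_real c.D 1)
          (fun _ => dW'_ne c.D 1) ι₁ (blockPosEquiv V) (blockNegEquiv V) eR eS (degOnePDual Empty) Φ₂ ℓ))) 0 (Complex.I • v) =
      Complex.I • fderiv ℝ (fun b => T (lineOmega_three V c.D hGR hGR₂ hGR₃ η₃ (BallForms.expP b)
        (blockFamilyOfAt (L : Type) e₁ (frameD V) (frameD_real V) (frameD_ne V) (lineVec (L : Type) (dW' c.D 1)) (fun _ => dW'_real c.D 1)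
          (fun _ => dW'_ne c.D 1) ι₁ (blockPosEquiv V) (blockNegEquiv V) eR eS (degOnePDual Empty) Φ₂ ℓ))) 0 v := by
  have h0 : lineOmega_three V c.D hGR hGR₂ hGR₃ η₃ (BallForms.expP 0)
      (blockFamilyOfAt (L : Type) e₁ (frameD V) (frameD_real V) (frameD_ne V) (lineVec (L : Type) (dW' c.D 1)) (fun _ => dW'_real c.D 1)
        (fun _ => dW'_ne c.D 1) ι₁ (blockPosEquiv V) (blockNegEquiv V) eR eS (degOnePDual Empty) Φ₂ ℓ) =
      blockFamilyOfAt (L : Type) e₁ (frameD V) (frameD_real V) (frameD_ne V) (lineVec (L : Type) (dW' c.D 1)) (fun _ => dW'_real c.D 1)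
        (fun _ => dW'_ne c.D 1) ι₁ (blockPosEquiv V) (blockNegEquiv V) eR eS (degOnePDual Empty) Φ₂ ℓ := by
    rw [BallForms.expP_zero, map_one, Module.End.one_apply]
  refine ThetaHolDirections.apply_I_smul_of_basis
    ((fderiv ℝ (fun b => T (lineOmega_three V c.D hGR hGR₂ hGR₃ η₃ (BallForms.expP b)
      (blockFamilyOfAt (L : Type) e₁ (frameD V) (frameD_real V) (frameD_ne V) (lineVec (L : Type) (dW' c.D 1)) (fun _ => dW'_real c.D 1)
        (fun _ => dW'_ne c.D 1) ι₁ (blockPosEquiv V) (blockNegEquiv V) eR eS (degOnePDual Empty) Φ₂ ℓ))) 0).toLinearMap)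
    (fun _ => -Complex.I) (fun _ => neg_ne_zero.2 Complex.I_ne_zero) (fun p => ?_) v
  obtain ⟨D, Dᵢ, hD, hDᵢ, hsum⟩ := pMinus_lineOmega_threeG V c hGR hGR₂ hGR₃ η₃ Φ₂ eR eS hemb p ℓ
  exact ThetaHolAssembly.fderiv_I_smul_of_slopes T
    (Ψ := fun b => lineOmega_three V c.D hGR hGR₂ hGR₃ η₃ (BallForms.expP b)
      (blockFamilyOfAt (L : Type) e₁ (frameD V) (frameD_real V) (frameD_ne V) (lineVec (L : Type) (dW' c.D 1)) (fun _ => dW'_real c.D 1)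
        (fun _ => dW'_ne c.D 1) ι₁ (blockPosEquiv V) (blockNegEquiv V) eR eS (degOnePDual Empty) Φ₂ ℓ))
    (hd_lineOmega_threeG V c hGR hGR₂ hGR₃ η₃ Φ₂ eR eS hemb T ℓ) _
    (by simpa only [h0] using hD) (by simpa only [h0] using hDᵢ) hsum

end Three

end Slots


end HodgeCM.Model

end
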